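import Mathlib
import HarnessLib
import Summits.HubbardSuperconductivity.HubbardSuperconductivity.Theorems.KLProgrammeKLRegimeTwoVolumeDualDefectPinned
import Summits.HubbardSuperconductivity.HubbardSuperconductivity.Theorems.KLProgrammeKLRegimeVolumeLimitLastScaleCommonFrameDoor
import Summits.HubbardSuperconductivity.HubbardSuperconductivity.Theorems.KLProgrammeKLRegimeVolumeLimitLastScaleUnits

/-!
# Route `KLProgramme` — crux K3, VL child `KLRegimeVolumeLimitV17F2` (stmt-HubbardSuperconductivity-20440): THE REGISTERED STUB TEXT FROM THE
# PLAIN ROWS OF THE LAST-SCALE ACTION ITSELF — the END door in the AMPUTATED currency of the augmented chain (blueprint v3 §A, read-out weight `w ≡ 1`)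
# (cell gate-hubbard-kl, seat hubbard-kl-k3c5-p3 g11, technique «OS-positivity-free direct assembly»)

Every earlier last-scale door of 20440 (`…LastScaleDualDoor` p552326, `…TwoVolumeDualDefectPinned` p553705, `…CommonFrameDualExact`, `…CommonFramePinned`,
`…CommonFramePinnedFree`, `…LastScaleUnits` §2, `…WeightedDualDoor`, `…DressedRows`) reads the rows of the SEPARATED data `𝒱_V⁽ⁿ⋆⁾[K] − 𝒩_K` (the
action minus the counter-quadratic), because the dual read-out was first written through `Σ[𝒱[K]] = K(p) + Σ[𝒱[K] − 𝒩_K]`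
(`klSelfEnergy_eq_eval_add_selfEnergy_sub_counter`).  The organisation of record for the (R-src)-augmented two-volume chain (plan (R59an)/(R59ao)/(R59bh);
k3c4-p1's blueprint v3 §A) is AMPUTATED: its scale-`n` object is `klSrcAction … n = map (toLin' [E_n | E_plain]) 𝒱⁽ⁿ⁾`, whose kernels with two plain
(«source») legs at `n⋆ = n_β + 1` are the plain position-space two-leg kernels of `𝒱⁽ⁿ⋆⁾[K_V]` ITSELF — counter-quadratic included.  This file supplies
the END doors that take EXACTLY those rows, so the chain's last object plugs in with no counter-term subtraction:

* §1 (namespace `TwoVolumeDefect`) — the model read-outs for `𝒱` itself: `rows_baseIndependent_klEffectiveAction` (diagonal two-leg kernel,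
  k3c5-p2's `kernel_two_offDiag_klEffectiveAction_sub_counter` + `kernel_counterQuadratic_two_offDiag`, `row_eq_of_diagonal`), **`norm_klSelfEnergy_sub_le_plainDualDefect`** (two volumes `L_f = b·L_c`, ANY two frames, any scale/label/spin,
  any pins: `‖Σ^{K_c}_{L_c}(ω,k) − Σ^{K_f}_{L_f}(ω,k″)‖ ≤ 2ε·(Ddef₊ + Dfar₊)` for the rows of `𝒱_c[K_c]`, `𝒱_f[K_f]` — NO frame term: the frame mismatch of
  the two counter-quadratics sits inside the row defect), `norm_klSelfEnergy_le_plainDualRows` (`‖Σ^K_L(ω,k)‖ ≤ 2ε·Σ_y‖R(o;y)‖`).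
* §2 (namespace `TwoPointAssembly`) — four doors to the registered text of `stub_vl_nestedFramed`:
  **`framedNestedFlowTextV17F2_of_plainRowsDualDefect`** — OWN flow frames, dual currency: stub ⟸ «per Matsubara integer ∃ L₀ δ→0: for `L ≥ L₀`, `L″ = b·L`,
  eventually in `M`, ∃ pins `o_c, o_f`: at every label of integer `n`, `2ε·(Ddef₊ + Dfar₊) ≤ δ L` for the rows of `𝒱_L[K_L]` vs `𝒱_{L″}[K_{L″}]`» — NOTHING
  else (no unit, no one-volume bound, no frame term, no tower datum is used: rate `ρ = δ`);
  **`framedNestedFlowTextV17F2_of_plainRowsPinnedDefect`** — OWN frames, pinned currency (phases dropped, times summed, pins with a common time): the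
  hypothesis is LABEL-FREE — «∃ L₀ δ→0: for `L ≥ L₀`, `L″ = b·L`, eventually in `M`, ∃ pins with `o_f.t = o_c.t`:
  `2ε·(Σ_{t₁,ȳ}‖W_L(o_c,(t₁,o⃗_c+ȳ)) − W_{L″}(o_f,(t₁,o⃗_f+ȳ↑))‖ + Σ_{t₁, y far}‖W_{L″}(o_f,(t₁,o⃗_f+y))‖) ≤ δ L`»;
  **`framedNestedFlowTextV17F2_of_commonFramePlainRowsDual`** / **`…_of_commonFramePlainRowsPinned`** — BOTH volumes at the coarse frame `K_L`
  (the fine volume's own-frame passage is k3c4-p2's exact last-scale algebra `framedNestedFlowTextV17F2_of_commonFrame_bounded`, its unit is free by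
  `isUnit_effPartitionFn_lastScale_eventually`): defect `≤ δ L` and one-volume rows `≤ B`.
Here `W_V = sectorisedKernel β (trivialMultiplier) (klEffectiveAction V M β U μ K klE0 (n_β+1)) 2 ((0,0,+),(0,0,−))`, `R_V(o;y) = Σ_{t₁} W_V(o,(t₁,o⃗+y))·e^{iω(t_o − t₁)}`,
`ε = imagTimeWeight β M`, `ȳ↑ = proj (cRep ȳ)`, «far» = `y ≠ (y mod L)↑`.  The by-`--workitem` closers are in `…VolumeLimitV17F2PlainRowsClosers`.
Proofs only; no definition; nothing asserts superconductivity.  References: BGM 2006 §2.4 (2.38), §2.9; FST 1996 §1.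
-/

noncomputable section

/-! ## §1 The model read-outs for the action itself (counter-quadratic included) -/

namespace Summit.HubbardSuperconductivity.HubbardSuperconductivity.Theorems.TwoVolumeDefect

set_option linter.dupNamespace false -- summit = problem name (single-conjunct summit), D-0017

open Finset Complex Literature.MathematicalPhysics.QuantumLattice Literature.Probability.LatticeModels GrassmannAlgebra
open Summit.HubbardSuperconductivity.HubbardSuperconductivity.Theorems.KLRegimeSplit
open Summit.HubbardSuperconductivity.HubbardSuperconductivity.Theorems.KLProgrammeLegKernels

section PlainModel

variable {Lc Lf b M : ℕ} [NeZero Lc] [NeZero Lf] [NeZero M]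

omit [NeZero Lf] in
/-- **The phase-weighted rows of the plain two-leg kernel of `𝒱⁽ⁿ⁾[K]` are base-point free** (every scale, frame, label, spin): the two-leg momentum
kernel of the action is diagonal (`kernel_two_offDiag_klEffectiveAction_sub_counter`, `kernel_counterQuadratic_two_offDiag`; row formula `row_eq_of_diagonal`). [cite: BenfattoGiulianiMastropietro2006, §2.3 (2.17)] -/
theorem rows_baseIndependent_klEffectiveAction {β : ℝ} (hβ : β ≠ 0) (U μ : ℝ) (K : TrigPolyC4v) (n : ℕ) (m : MatsubaraIdx M) (σ : Fin 2)
    (x₀ x₀' : SpaceTimeIdx Lc M) (z : TorusSite 2 Lc) :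
    (∑ t₁ : ImagTimeIdx M,
        sectorisedKernel Lc M β (trivialMultiplier Lc M) (klEffectiveAction Lc M β U μ K klE0 n) 2
            (![((0, σ), 0), ((0, σ), 1)] : Fin 2 → SectorLeg 1) ![x₀, (t₁, x₀.2 + z)] *
          Complex.exp (((matsubaraFreq β M m * (imagTime β M x₀.1 - imagTime β M t₁) : ℝ) : ℂ) * I)) =
      ∑ t₁ : ImagTimeIdx M,
        sectorisedKernel Lc M β (trivialMultiplier Lc M) (klEffectiveAction Lc M β U μ K klE0 n) 2
            (![((0, σ), 0), ((0, σ), 1)] : Fin 2 → SectorLeg 1) ![x₀', (t₁, x₀'.2 + z)] *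
          Complex.exp (((matsubaraFreq β M m * (imagTime β M x₀'.1 - imagTime β M t₁) : ℝ) : ℂ) * I) := by
  -- the two-leg momentum kernel of `𝒱⁽ⁿ⁾[K]` is diagonal: the separated data are (k3c5-p2) and so is the counter-quadratic
  have hdiag : ∀ k k' : FreqMomentum Lc M, k' ≠ k →
      kernel ℂ (klEffectiveAction Lc M β U μ K klE0 n) 2 ![((k, σ), 0), ((k', σ), 1)] = 0 := by
    intro k k' hk
    have h := kernel_two_offDiag_klEffectiveAction_sub_counter (L := Lc) (M := M) β U μ K n σ k k' hk
    rwa [TwoLegFourier.kernel_sub', kernel_counterQuadratic_two_offDiag β K σ hk, sub_zero] at h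
  rw [row_eq_of_diagonal hβ _ m σ hdiag x₀ z, row_eq_of_diagonal hβ _ m σ hdiag x₀' z]

/-- **THE VL READ-OUT FOR THE ACTION ITSELF, TWO VOLUMES, ANY TWO FRAMES** (`0 < β`, `L_f = b·L_c`, common `M`, scale `n`, label `ω`, spin `σ`, ANY pins
`o_c`, `o_f`, momenta with `p_{k″} = p_k`):
`‖klSelfEnergy Lc … Kc klE0 n (ω,k) σ − klSelfEnergy Lf … Kf klE0 n (ω,k″) σ‖ ≤ 2ε·(Ddef₊ + Dfar₊)` for the rows of `𝒱_c[K_c]` and `𝒱_f[K_f]` — NO frame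
term, NO counter-term subtraction (`klSelfEnergy = selfEnergy 𝒱` by definition). [cite: BenfattoGiulianiMastropietro2006, §2.4 (2.38)] -/
theorem norm_klSelfEnergy_sub_le_plainDualDefect (hL : Lf = b * Lc) {β : ℝ} (hβ : 0 < β) (U μ : ℝ) (Kc Kf : TrigPolyC4v) (n : ℕ)
    (ω : MatsubaraIdx M) (σ : Fin 2) (oc : SpaceTimeIdx Lc M) (of : SpaceTimeIdx Lf M)
    {k : TorusSite 2 Lc} {k'' : TorusSite 2 Lf} (hk : latticeMomentum Lf k'' = latticeMomentum Lc k) :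
    ‖klSelfEnergy Lc M β U μ Kc klE0 n (ω, k) σ - klSelfEnergy Lf M β U μ Kf klE0 n (ω, k'') σ‖ ≤
      2 * imagTimeWeight β M *
        ((∑ ybar : TorusSite 2 Lc,
            ‖(∑ t₁ : ImagTimeIdx M,
                sectorisedKernel Lc M β (trivialMultiplier Lc M) (klEffectiveAction Lc M β U μ Kc klE0 n) 2
                    (![((0, σ), 0), ((0, σ), 1)] : Fin 2 → SectorLeg 1) ![oc, (t₁, oc.2 + ybar)] *
                  Complex.exp (((matsubaraFreq β M ω * (imagTime β M oc.1 - imagTime β M t₁) : ℝ) : ℂ) * I)) -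
              (∑ t₁ : ImagTimeIdx M,
                sectorisedKernel Lf M β (trivialMultiplier Lf M) (klEffectiveAction Lf M β U μ Kf klE0 n) 2
                    (![((0, σ), 0), ((0, σ), 1)] : Fin 2 → SectorLeg 1) ![of, (t₁, of.2 + Torus.proj Lf (Torus.cRep ybar))] *
                  Complex.exp (((matsubaraFreq β M ω * (imagTime β M of.1 - imagTime β M t₁) : ℝ) : ℂ) * I))‖) +
          ∑ y ∈ univ.filter (fun y : TorusSite 2 Lf => Torus.proj Lf (Torus.cRep (fun i => (((y i).val : ℕ) : ZMod Lc))) ≠ y),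
            ‖∑ t₁ : ImagTimeIdx M,
                sectorisedKernel Lf M β (trivialMultiplier Lf M) (klEffectiveAction Lf M β U μ Kf klE0 n) 2
                    (![((0, σ), 0), ((0, σ), 1)] : Fin 2 → SectorLeg 1) ![of, (t₁, of.2 + y)] *
                  Complex.exp (((matsubaraFreq β M ω * (imagTime β M of.1 - imagTime β M t₁) : ℝ) : ℂ) * I)‖) := by
  simp only [klSelfEnergy]
  exact norm_selfEnergy_sub_le_dualDefect_of_latticeMomentum_eq hL hβ _ _ ω σ
    (rows_baseIndependent_klEffectiveAction hβ.ne' U μ Kc n ω σ) (rows_baseIndependent_klEffectiveAction hβ.ne' U μ Kf n ω σ) oc of hk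

omit [NeZero Lf] in
/-- **One-volume size for the action itself**: `‖klSelfEnergy L … K klE0 n (ω,k) σ‖ ≤ 2ε·Σ_y ‖R(o;y)‖` for the rows of `𝒱[K]`, any pin `o`.
[cite: BenfattoGiulianiMastropietro2006, §2.1 (2.5)] -/
theorem norm_klSelfEnergy_le_plainDualRows {β : ℝ} (hβ : 0 < β) (U μ : ℝ) (K : TrigPolyC4v) (n : ℕ) (ω : MatsubaraIdx M) (σ : Fin 2)
    (o : SpaceTimeIdx Lc M) (k : TorusSite 2 Lc) :
    ‖klSelfEnergy Lc M β U μ K klE0 n (ω, k) σ‖ ≤ 2 * imagTimeWeight β M * ∑ y : TorusSite 2 Lc,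
      ‖∑ t₁ : ImagTimeIdx M,
          sectorisedKernel Lc M β (trivialMultiplier Lc M) (klEffectiveAction Lc M β U μ K klE0 n) 2
              (![((0, σ), 0), ((0, σ), 1)] : Fin 2 → SectorLeg 1) ![o, (t₁, o.2 + y)] *
            Complex.exp (((matsubaraFreq β M ω * (imagTime β M o.1 - imagTime β M t₁) : ℝ) : ℂ) * I)‖ := by
  simp only [klSelfEnergy]
  exact norm_selfEnergy_le_dualRows hβ _ ω σ (rows_baseIndependent_klEffectiveAction hβ.ne' U μ K n ω σ) o k

end PlainModel

end Summit.HubbardSuperconductivity.HubbardSuperconductivity.Theorems.TwoVolumeDefect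

/-! ## §2 The four doors to the registered stub text -/

namespace Summit.HubbardSuperconductivity.HubbardSuperconductivity.Theorems.TwoPointAssembly

set_option linter.dupNamespace false -- summit = problem name (single-conjunct summit), D-0017

open Finset Filter Topology Complex Literature.MathematicalPhysics.QuantumLattice Literature.Probability.LatticeModels GrassmannAlgebra
open Summit.HubbardSuperconductivity.HubbardSuperconductivity.Theorems.KLRegimeSplit
open Summit.HubbardSuperconductivity.HubbardSuperconductivity.Theorems.KLProgrammeLegKernels
open Summit.HubbardSuperconductivity.HubbardSuperconductivity.Theorems.TwoVolumeDefect

/-- **DOOR (a) — OWN FRAMES, DUAL CURRENCY, NOTHING ELSE.**  The registered text of `stub_vl_nestedFramed` from: per Matsubara integer `n`, `∃ L₀ δ→0`,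
for `L ≥ L₀`, `L″ = b·L`, eventually in `M`, pins `o_c, o_f` with `2ε·(Ddef₊ + Dfar₊) ≤ δ L` at every label of integer `n` — rows of the plain two-leg
kernels of `𝒱_L[K_L]` and `𝒱_{L″}[K_{L″}]`, `K_V = klFlowFrameU V M β U μ (n_β+1)`, spin `0`, scale `n_β+1`.  Rate `ρ = δ`; no tower datum is used.
[cite: BenfattoGiulianiMastropietro2006, §2.4 (2.38)] -/
theorem framedNestedFlowTextV17F2_of_plainRowsDualDefect
    (hD : ∀ (G : GeoConsts) (P : SplitConsts) (Q : EngConsts) (R : RenConsts), G.WF → P.WF → Q.WF → R.WF →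
      ∃ c₅ : ℝ, 0 < c₅ ∧ ∀ c : ℝ, 0 < c → c ≤ c₅ → ∃ U₀ : ℝ, 0 < U₀ ∧
        ∀ μ ∈ klWindowC, ∀ U : ℝ, 0 < U → U ≤ U₀ → ∀ β : ℝ, klBetaMin ≤ β → β ≤ Real.exp (c / U ^ 2) →
          ∀ K : TrigPolyC4v, klPredsV17F2.frameOK R U (nScales β) μ K →
            ∀ (Lstar : ℕ) (Mstar : ℕ → ℕ), TowerP klPredsV17F2 G P Q R β U μ K Lstar Mstar →
              ∀ n : ℤ, ∃ L₀ : ℕ, ∃ δ : ℕ → ℝ, Tendsto δ atTop (𝓝 0) ∧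
                ∀ (L : ℕ) [NeZero L], L₀ ≤ L → ∀ (L'' : ℕ) [NeZero L''] (b : ℕ), L'' = b * L → ∃ M₀ : ℕ, ∀ (M : ℕ) [NeZero M], M₀ ≤ M →
                  ∃ (oc : SpaceTimeIdx L M) (of : SpaceTimeIdx L'' M), ∀ ω : MatsubaraIdx M, matsubaraInt M ω = n →
                    2 * imagTimeWeight β M *
                      ((∑ ybar : TorusSite 2 L,
                          ‖(∑ t₁ : ImagTimeIdx M,
                              sectorisedKernel L M β (trivialMultiplier L M)
                                  (klEffectiveAction L M β U μ (klFlowFrameU L M β U μ (nScales β + 1)) klE0 (nScales β + 1)) 2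
                                  (![((0, 0), 0), ((0, 0), 1)] : Fin 2 → SectorLeg 1) ![oc, (t₁, oc.2 + ybar)] *
                                Complex.exp (((matsubaraFreq β M ω * (imagTime β M oc.1 - imagTime β M t₁) : ℝ) : ℂ) * I)) -
                            (∑ t₁ : ImagTimeIdx M,
                              sectorisedKernel L'' M β (trivialMultiplier L'' M)
                                  (klEffectiveAction L'' M β U μ (klFlowFrameU L'' M β U μ (nScales β + 1)) klE0 (nScales β + 1)) 2
                                  (![((0, 0), 0), ((0, 0), 1)] : Fin 2 → SectorLeg 1) ![of, (t₁, of.2 + Torus.proj L'' (Torus.cRep ybar))] *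
                                Complex.exp (((matsubaraFreq β M ω * (imagTime β M of.1 - imagTime β M t₁) : ℝ) : ℂ) * I))‖) +
                        ∑ y ∈ univ.filter (fun y : TorusSite 2 L'' => Torus.proj L'' (Torus.cRep (fun i => (((y i).val : ℕ) : ZMod L))) ≠ y),
                          ‖∑ t₁ : ImagTimeIdx M,
                              sectorisedKernel L'' M β (trivialMultiplier L'' M)
                                  (klEffectiveAction L'' M β U μ (klFlowFrameU L'' M β U μ (nScales β + 1)) klE0 (nScales β + 1)) 2
                                  (![((0, 0), 0), ((0, 0), 1)] : Fin 2 → SectorLeg 1) ![of, (t₁, of.2 + y)] *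
                                Complex.exp (((matsubaraFreq β M ω * (imagTime β M of.1 - imagTime β M t₁) : ℝ) : ℂ) * I)‖) ≤ δ L) :
    ∀ (G : GeoConsts) (P : SplitConsts) (Q : EngConsts) (R : RenConsts), G.WF → P.WF → Q.WF → R.WF →
      ∃ c₅ : ℝ, 0 < c₅ ∧ ∀ c : ℝ, 0 < c → c ≤ c₅ → ∃ U₀ : ℝ, 0 < U₀ ∧
        ∀ μ ∈ klWindowC, ∀ U : ℝ, 0 < U → U ≤ U₀ → ∀ β : ℝ, klBetaMin ≤ β → β ≤ Real.exp (c / U ^ 2) →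
          ∀ K : TrigPolyC4v, klPredsV17F2.frameOK R U (nScales β) μ K →
            ∀ (Lstar : ℕ) (Mstar : ℕ → ℕ), TowerP klPredsV17F2 G P Q R β U μ K Lstar Mstar →
              ∀ n : ℤ, ∃ L₀ : ℕ, ∃ ρ : ℕ → ℝ, Tendsto ρ atTop (𝓝 0) ∧
                ∀ (L : ℕ) [NeZero L], L₀ ≤ L → ∀ (L'' : ℕ) [NeZero L''], L ∣ L'' → ∃ M₀ : ℕ, ∀ (M : ℕ) [NeZero M], M₀ ≤ M →
                  ∀ (ω : MatsubaraIdx M), matsubaraInt M ω = n → ∀ (k : TorusSite 2 L) (k'' : TorusSite 2 L''),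
                    latticeMomentum L'' k'' = latticeMomentum L k →
                      ‖klSelfEnergy L M β U μ (klFlowFrameU L M β U μ (nScales β + 1)) klE0 (nScales β + 1) (ω, k) 0 -
                          klSelfEnergy L'' M β U μ (klFlowFrameU L'' M β U μ (nScales β + 1)) klE0 (nScales β + 1) (ω, k'') 0‖ ≤ ρ L := by
  intro G P Q R hG hP hQ hR
  obtain ⟨c₅, hc₅, hc⟩ := hD G P Q R hG hP hQ hR
  refine ⟨c₅, hc₅, fun c hc0 hcc => ?_⟩
  obtain ⟨U₀, hU₀, hU⟩ := hc c hc0 hcc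
  refine ⟨U₀, hU₀, fun μ hμ U hU0 hUU β hβmin hβmax K hK Lstar Mstar hT n => ?_⟩
  have hβ : 0 < β := pos_of_klBetaMin_le hβmin
  obtain ⟨L₀, δ, hδ, hDn⟩ := hU μ hμ U hU0 hUU β hβmin hβmax K hK Lstar Mstar hT n
  refine ⟨L₀, δ, hδ, fun L _ hL L'' _ hdvd => ?_⟩
  obtain ⟨b, hb⟩ := hdvd
  have hb' : L'' = b * L := by rw [hb, mul_comm]
  obtain ⟨M₀, hM₀⟩ := hDn L hL L'' b hb'
  refine ⟨M₀, fun M _ hM ω hω k k'' hk => ?_⟩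
  obtain ⟨oc, of, hw⟩ := hM₀ M hM
  exact (norm_klSelfEnergy_sub_le_plainDualDefect hb' hβ U μ _ _ (nScales β + 1) ω 0 oc of hk).trans (hw ω hω)

/-- **DOOR (b) — OWN FRAMES, PINNED CURRENCY, LABEL-FREE HYPOTHESIS.**  The registered text of `stub_vl_nestedFramed` from: `∃ L₀ δ→0`, for `L ≥ L₀`,
`L″ = b·L`, eventually in `M`, pins `o_c, o_f` WITH A COMMON TIME such that the pinned `ℓ¹` two-volume defect (phases dropped, times summed) of the plain
two-leg kernels of `𝒱_L[K_L]` vs `𝒱_{L″}[K_{L″}]` plus the far rows of `𝒱_{L″}[K_{L″}]` is `≤ δ L / (2ε)` — one datum for every Matsubara label at once.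
[cite: BenfattoGiulianiMastropietro2006, §2.4 (2.38)] -/
theorem framedNestedFlowTextV17F2_of_plainRowsPinnedDefect
    (hD : ∀ (G : GeoConsts) (P : SplitConsts) (Q : EngConsts) (R : RenConsts), G.WF → P.WF → Q.WF → R.WF →
      ∃ c₅ : ℝ, 0 < c₅ ∧ ∀ c : ℝ, 0 < c → c ≤ c₅ → ∃ U₀ : ℝ, 0 < U₀ ∧
        ∀ μ ∈ klWindowC, ∀ U : ℝ, 0 < U → U ≤ U₀ → ∀ β : ℝ, klBetaMin ≤ β → β ≤ Real.exp (c / U ^ 2) →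
          ∀ K : TrigPolyC4v, klPredsV17F2.frameOK R U (nScales β) μ K →
            ∀ (Lstar : ℕ) (Mstar : ℕ → ℕ), TowerP klPredsV17F2 G P Q R β U μ K Lstar Mstar →
              ∃ L₀ : ℕ, ∃ δ : ℕ → ℝ, Tendsto δ atTop (𝓝 0) ∧
                ∀ (L : ℕ) [NeZero L], L₀ ≤ L → ∀ (L'' : ℕ) [NeZero L''] (b : ℕ), L'' = b * L → ∃ M₀ : ℕ, ∀ (M : ℕ) [NeZero M], M₀ ≤ M →
                  ∃ (oc : SpaceTimeIdx L M) (of : SpaceTimeIdx L'' M), of.1 = oc.1 ∧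
                    2 * imagTimeWeight β M *
                      ((∑ t₁ : ImagTimeIdx M, ∑ ybar : TorusSite 2 L,
                          ‖sectorisedKernel L M β (trivialMultiplier L M)
                                (klEffectiveAction L M β U μ (klFlowFrameU L M β U μ (nScales β + 1)) klE0 (nScales β + 1)) 2
                                (![((0, 0), 0), ((0, 0), 1)] : Fin 2 → SectorLeg 1) ![oc, (t₁, oc.2 + ybar)] -
                            sectorisedKernel L'' M β (trivialMultiplier L'' M)
                                (klEffectiveAction L'' M β U μ (klFlowFrameU L'' M β U μ (nScales β + 1)) klE0 (nScales β + 1)) 2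
                                (![((0, 0), 0), ((0, 0), 1)] : Fin 2 → SectorLeg 1) ![of, (t₁, of.2 + Torus.proj L'' (Torus.cRep ybar))]‖) +
                        ∑ t₁ : ImagTimeIdx M,
                          ∑ y ∈ univ.filter (fun y : TorusSite 2 L'' => Torus.proj L'' (Torus.cRep (fun i => (((y i).val : ℕ) : ZMod L))) ≠ y),
                            ‖sectorisedKernel L'' M β (trivialMultiplier L'' M)
                                (klEffectiveAction L'' M β U μ (klFlowFrameU L'' M β U μ (nScales β + 1)) klE0 (nScales β + 1)) 2
                                (![((0, 0), 0), ((0, 0), 1)] : Fin 2 → SectorLeg 1) ![of, (t₁, of.2 + y)]‖) ≤ δ L) :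
    ∀ (G : GeoConsts) (P : SplitConsts) (Q : EngConsts) (R : RenConsts), G.WF → P.WF → Q.WF → R.WF →
      ∃ c₅ : ℝ, 0 < c₅ ∧ ∀ c : ℝ, 0 < c → c ≤ c₅ → ∃ U₀ : ℝ, 0 < U₀ ∧
        ∀ μ ∈ klWindowC, ∀ U : ℝ, 0 < U → U ≤ U₀ → ∀ β : ℝ, klBetaMin ≤ β → β ≤ Real.exp (c / U ^ 2) →
          ∀ K : TrigPolyC4v, klPredsV17F2.frameOK R U (nScales β) μ K →
            ∀ (Lstar : ℕ) (Mstar : ℕ → ℕ), TowerP klPredsV17F2 G P Q R β U μ K Lstar Mstar →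
              ∀ n : ℤ, ∃ L₀ : ℕ, ∃ ρ : ℕ → ℝ, Tendsto ρ atTop (𝓝 0) ∧
                ∀ (L : ℕ) [NeZero L], L₀ ≤ L → ∀ (L'' : ℕ) [NeZero L''], L ∣ L'' → ∃ M₀ : ℕ, ∀ (M : ℕ) [NeZero M], M₀ ≤ M →
                  ∀ (ω : MatsubaraIdx M), matsubaraInt M ω = n → ∀ (k : TorusSite 2 L) (k'' : TorusSite 2 L''),
                    latticeMomentum L'' k'' = latticeMomentum L k →
                      ‖klSelfEnergy L M β U μ (klFlowFrameU L M β U μ (nScales β + 1)) klE0 (nScales β + 1) (ω, k) 0 -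
                          klSelfEnergy L'' M β U μ (klFlowFrameU L'' M β U μ (nScales β + 1)) klE0 (nScales β + 1) (ω, k'') 0‖ ≤ ρ L := by
  refine framedNestedFlowTextV17F2_of_plainRowsDualDefect fun G P Q R hG hP hQ hR => ?_
  obtain ⟨c₅, hc₅, hc⟩ := hD G P Q R hG hP hQ hR
  refine ⟨c₅, hc₅, fun c hc0 hcc => ?_⟩
  obtain ⟨U₀, hU₀, hU⟩ := hc c hc0 hcc
  refine ⟨U₀, hU₀, fun μ hμ U hU0 hUU β hβmin hβmax K hK Lstar Mstar hT n => ?_⟩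
  have hβ : 0 < β := pos_of_klBetaMin_le hβmin
  obtain ⟨L₀, δ, hδ, hDn⟩ := hU μ hμ U hU0 hUU β hβmin hβmax K hK Lstar Mstar hT
  refine ⟨L₀, δ, hδ, fun L _ hL L'' _ b hb => ?_⟩
  obtain ⟨M₀, hM₀⟩ := hDn L hL L'' b hb
  refine ⟨M₀, fun M _ hM => ?_⟩
  obtain ⟨oc, of, ht, hdef⟩ := hM₀ M hM
  have hε : 0 ≤ 2 * imagTimeWeight β M := by have := imagTimeWeight_nonneg hβ.le M; positivity
  refine ⟨oc, of, fun ω _ => ?_⟩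
  exact (mul_le_mul_of_nonneg_left (dualRows_le_pinnedDefect _ _ β ω oc of ht) hε).trans hdef

/-- **DOOR (c) — COMMON FRAME `K_L`, DUAL CURRENCY.**  The registered text of `stub_vl_nestedFramed` from: per Matsubara integer `n`, `∃ L₀ δ→0 B`, for
`L ≥ L₀`, `L″ = b·L`, eventually in `M`, pins `o_c, o_f` with, at every label of integer `n`, `2ε·(Ddef₊ + Dfar₊) ≤ δ L` for the rows of `𝒱_L[K_L]` vs
`𝒱_{L″}[K_L]` (BOTH volumes at the coarse flow frame) and `2ε·Σ_y‖R_L(o_c;y)‖ ≤ B`.  The own-frame passage of the fine volume is k3c4-p2's exact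
last-scale algebra (`framedNestedFlowTextV17F2_of_commonFrame_bounded`), its unit is free (`isUnit_effPartitionFn_lastScale_eventually`).
[cite: BenfattoGiulianiMastropietro2006, §2.4 (2.38)] -/
theorem framedNestedFlowTextV17F2_of_commonFramePlainRowsDual
    (hD : ∀ (G : GeoConsts) (P : SplitConsts) (Q : EngConsts) (R : RenConsts), G.WF → P.WF → Q.WF → R.WF →
      ∃ c₅ : ℝ, 0 < c₅ ∧ ∀ c : ℝ, 0 < c → c ≤ c₅ → ∃ U₀ : ℝ, 0 < U₀ ∧
        ∀ μ ∈ klWindowC, ∀ U : ℝ, 0 < U → U ≤ U₀ → ∀ β : ℝ, klBetaMin ≤ β → β ≤ Real.exp (c / U ^ 2) →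
          ∀ K : TrigPolyC4v, klPredsV17F2.frameOK R U (nScales β) μ K →
            ∀ (Lstar : ℕ) (Mstar : ℕ → ℕ), TowerP klPredsV17F2 G P Q R β U μ K Lstar Mstar →
              ∀ n : ℤ, ∃ L₀ : ℕ, ∃ δ : ℕ → ℝ, ∃ B : ℝ, Tendsto δ atTop (𝓝 0) ∧
                ∀ (L : ℕ) [NeZero L], L₀ ≤ L → ∀ (L'' : ℕ) [NeZero L''] (b : ℕ), L'' = b * L → ∃ M₀ : ℕ, ∀ (M : ℕ) [NeZero M], M₀ ≤ M →
                  ∃ (oc : SpaceTimeIdx L M) (of : SpaceTimeIdx L'' M), ∀ ω : MatsubaraIdx M, matsubaraInt M ω = n →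
                    2 * imagTimeWeight β M *
                      ((∑ ybar : TorusSite 2 L,
                          ‖(∑ t₁ : ImagTimeIdx M,
                              sectorisedKernel L M β (trivialMultiplier L M)
                                  (klEffectiveAction L M β U μ (klFlowFrameU L M β U μ (nScales β + 1)) klE0 (nScales β + 1)) 2
                                  (![((0, 0), 0), ((0, 0), 1)] : Fin 2 → SectorLeg 1) ![oc, (t₁, oc.2 + ybar)] *
                                Complex.exp (((matsubaraFreq β M ω * (imagTime β M oc.1 - imagTime β M t₁) : ℝ) : ℂ) * I)) -
                            (∑ t₁ : ImagTimeIdx M,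
                              sectorisedKernel L'' M β (trivialMultiplier L'' M)
                                  (klEffectiveAction L'' M β U μ (klFlowFrameU L M β U μ (nScales β + 1)) klE0 (nScales β + 1)) 2
                                  (![((0, 0), 0), ((0, 0), 1)] : Fin 2 → SectorLeg 1) ![of, (t₁, of.2 + Torus.proj L'' (Torus.cRep ybar))] *
                                Complex.exp (((matsubaraFreq β M ω * (imagTime β M of.1 - imagTime β M t₁) : ℝ) : ℂ) * I))‖) +
                        ∑ y ∈ univ.filter (fun y : TorusSite 2 L'' => Torus.proj L'' (Torus.cRep (fun i => (((y i).val : ℕ) : ZMod L))) ≠ y),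
                          ‖∑ t₁ : ImagTimeIdx M,
                              sectorisedKernel L'' M β (trivialMultiplier L'' M)
                                  (klEffectiveAction L'' M β U μ (klFlowFrameU L M β U μ (nScales β + 1)) klE0 (nScales β + 1)) 2
                                  (![((0, 0), 0), ((0, 0), 1)] : Fin 2 → SectorLeg 1) ![of, (t₁, of.2 + y)] *
                                Complex.exp (((matsubaraFreq β M ω * (imagTime β M of.1 - imagTime β M t₁) : ℝ) : ℂ) * I)‖) ≤ δ L ∧
                    2 * imagTimeWeight β M * ∑ y : TorusSite 2 L,
                      ‖∑ t₁ : ImagTimeIdx M,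
                          sectorisedKernel L M β (trivialMultiplier L M)
                              (klEffectiveAction L M β U μ (klFlowFrameU L M β U μ (nScales β + 1)) klE0 (nScales β + 1)) 2
                              (![((0, 0), 0), ((0, 0), 1)] : Fin 2 → SectorLeg 1) ![oc, (t₁, oc.2 + y)] *
                            Complex.exp (((matsubaraFreq β M ω * (imagTime β M oc.1 - imagTime β M t₁) : ℝ) : ℂ) * I)‖ ≤ B) :
    ∀ (G : GeoConsts) (P : SplitConsts) (Q : EngConsts) (R : RenConsts), G.WF → P.WF → Q.WF → R.WF →
      ∃ c₅ : ℝ, 0 < c₅ ∧ ∀ c : ℝ, 0 < c → c ≤ c₅ → ∃ U₀ : ℝ, 0 < U₀ ∧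
        ∀ μ ∈ klWindowC, ∀ U : ℝ, 0 < U → U ≤ U₀ → ∀ β : ℝ, klBetaMin ≤ β → β ≤ Real.exp (c / U ^ 2) →
          ∀ K : TrigPolyC4v, klPredsV17F2.frameOK R U (nScales β) μ K →
            ∀ (Lstar : ℕ) (Mstar : ℕ → ℕ), TowerP klPredsV17F2 G P Q R β U μ K Lstar Mstar →
              ∀ n : ℤ, ∃ L₀ : ℕ, ∃ ρ : ℕ → ℝ, Tendsto ρ atTop (𝓝 0) ∧
                ∀ (L : ℕ) [NeZero L], L₀ ≤ L → ∀ (L'' : ℕ) [NeZero L''], L ∣ L'' → ∃ M₀ : ℕ, ∀ (M : ℕ) [NeZero M], M₀ ≤ M →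
                  ∀ (ω : MatsubaraIdx M), matsubaraInt M ω = n → ∀ (k : TorusSite 2 L) (k'' : TorusSite 2 L''),
                    latticeMomentum L'' k'' = latticeMomentum L k →
                      ‖klSelfEnergy L M β U μ (klFlowFrameU L M β U μ (nScales β + 1)) klE0 (nScales β + 1) (ω, k) 0 -
                          klSelfEnergy L'' M β U μ (klFlowFrameU L'' M β U μ (nScales β + 1)) klE0 (nScales β + 1) (ω, k'') 0‖ ≤ ρ L := by
  refine framedNestedFlowTextV17F2_of_commonFrame_bounded fun G P Q R hG hP hQ hR => ?_
  obtain ⟨c₅, hc₅, hc⟩ := hD G P Q R hG hP hQ hR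
  refine ⟨c₅, hc₅, fun c hc0 hcc => ?_⟩
  obtain ⟨U₀, hU₀, hU⟩ := hc c hc0 hcc
  refine ⟨U₀, hU₀, fun μ hμ U hU0 hUU β hβmin hβmax K hK Lstar Mstar hT n => ?_⟩
  have hβ : 0 < β := pos_of_klBetaMin_le hβmin
  obtain ⟨L₀, δ, B, hδ, hDn⟩ := hU μ hμ U hU0 hUU β hβmin hβmax K hK Lstar Mstar hT n
  refine ⟨max L₀ 3, δ, B, hδ, fun L _ hL L'' _ hdvd => ?_⟩
  obtain ⟨b, hb⟩ := hdvd
  have hb' : L'' = b * L := by rw [hb, mul_comm]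
  have hL₀ : L₀ ≤ L := (le_max_left _ _).trans hL
  have hL3 : 3 ≤ L := (le_max_right _ _).trans hL
  have hL'' : 3 ≤ L'' := hL3.trans (Nat.le_of_dvd (Nat.pos_of_ne_zero (NeZero.ne L'')) ⟨b, hb⟩)
  obtain ⟨M₀, hM₀⟩ := hDn L hL₀ L'' b hb'
  obtain ⟨M₁, hM₁⟩ := isUnit_effPartitionFn_lastScale_eventually (L := L'') hβ U μ hL''
  refine ⟨max M₀ M₁, fun M _ hM ω hω k k'' hk => ?_⟩
  obtain ⟨oc, of, hw⟩ := hM₀ M ((le_max_left _ _).trans hM)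
  obtain ⟨hdef, hB⟩ := hw ω hω
  exact ⟨hM₁ M ((le_max_right _ _).trans hM) _,
    (norm_klSelfEnergy_sub_le_plainDualDefect hb' hβ U μ _ _ (nScales β + 1) ω 0 oc of hk).trans hdef,
    (norm_klSelfEnergy_le_plainDualRows hβ U μ _ (nScales β + 1) ω 0 oc k).trans hB⟩

/-- **DOOR (d) — COMMON FRAME `K_L`, PINNED CURRENCY, LABEL-FREE HYPOTHESIS.**  The registered text of `stub_vl_nestedFramed` from: `∃ L₀ δ→0 B`, for
`L ≥ L₀`, `L″ = b·L`, eventually in `M`, pins with a common time such that the pinned `ℓ¹` two-volume defect + far rows of the plain two-leg kernels of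
`𝒱_L[K_L]` vs `𝒱_{L″}[K_L]` is `≤ δ L / (2ε)` and the pinned rows of `𝒱_L[K_L]` are `≤ B / (2ε)`. [cite: BenfattoGiulianiMastropietro2006, §2.4 (2.38)] -/
theorem framedNestedFlowTextV17F2_of_commonFramePlainRowsPinned
    (hD : ∀ (G : GeoConsts) (P : SplitConsts) (Q : EngConsts) (R : RenConsts), G.WF → P.WF → Q.WF → R.WF →
      ∃ c₅ : ℝ, 0 < c₅ ∧ ∀ c : ℝ, 0 < c → c ≤ c₅ → ∃ U₀ : ℝ, 0 < U₀ ∧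
        ∀ μ ∈ klWindowC, ∀ U : ℝ, 0 < U → U ≤ U₀ → ∀ β : ℝ, klBetaMin ≤ β → β ≤ Real.exp (c / U ^ 2) →
          ∀ K : TrigPolyC4v, klPredsV17F2.frameOK R U (nScales β) μ K →
            ∀ (Lstar : ℕ) (Mstar : ℕ → ℕ), TowerP klPredsV17F2 G P Q R β U μ K Lstar Mstar →
              ∃ L₀ : ℕ, ∃ δ : ℕ → ℝ, ∃ B : ℝ, Tendsto δ atTop (𝓝 0) ∧
                ∀ (L : ℕ) [NeZero L], L₀ ≤ L → ∀ (L'' : ℕ) [NeZero L''] (b : ℕ), L'' = b * L → ∃ M₀ : ℕ, ∀ (M : ℕ) [NeZero M], M₀ ≤ M →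
                  ∃ (oc : SpaceTimeIdx L M) (of : SpaceTimeIdx L'' M), of.1 = oc.1 ∧
                    2 * imagTimeWeight β M *
                      ((∑ t₁ : ImagTimeIdx M, ∑ ybar : TorusSite 2 L,
                          ‖sectorisedKernel L M β (trivialMultiplier L M)
                                (klEffectiveAction L M β U μ (klFlowFrameU L M β U μ (nScales β + 1)) klE0 (nScales β + 1)) 2
                                (![((0, 0), 0), ((0, 0), 1)] : Fin 2 → SectorLeg 1) ![oc, (t₁, oc.2 + ybar)] -
                            sectorisedKernel L'' M β (trivialMultiplier L'' M)
                                (klEffectiveAction L'' M β U μ (klFlowFrameU L M β U μ (nScales β + 1)) klE0 (nScales β + 1)) 2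
                                (![((0, 0), 0), ((0, 0), 1)] : Fin 2 → SectorLeg 1) ![of, (t₁, of.2 + Torus.proj L'' (Torus.cRep ybar))]‖) +
                        ∑ t₁ : ImagTimeIdx M,
                          ∑ y ∈ univ.filter (fun y : TorusSite 2 L'' => Torus.proj L'' (Torus.cRep (fun i => (((y i).val : ℕ) : ZMod L))) ≠ y),
                            ‖sectorisedKernel L'' M β (trivialMultiplier L'' M)
                                (klEffectiveAction L'' M β U μ (klFlowFrameU L M β U μ (nScales β + 1)) klE0 (nScales β + 1)) 2
                                (![((0, 0), 0), ((0, 0), 1)] : Fin 2 → SectorLeg 1) ![of, (t₁, of.2 + y)]‖) ≤ δ L ∧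
                    2 * imagTimeWeight β M *
                      ∑ t₁ : ImagTimeIdx M, ∑ y : TorusSite 2 L,
                        ‖sectorisedKernel L M β (trivialMultiplier L M)
                            (klEffectiveAction L M β U μ (klFlowFrameU L M β U μ (nScales β + 1)) klE0 (nScales β + 1)) 2
                            (![((0, 0), 0), ((0, 0), 1)] : Fin 2 → SectorLeg 1) ![oc, (t₁, oc.2 + y)]‖ ≤ B) :
    ∀ (G : GeoConsts) (P : SplitConsts) (Q : EngConsts) (R : RenConsts), G.WF → P.WF → Q.WF → R.WF →
      ∃ c₅ : ℝ, 0 < c₅ ∧ ∀ c : ℝ, 0 < c → c ≤ c₅ → ∃ U₀ : ℝ, 0 < U₀ ∧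
        ∀ μ ∈ klWindowC, ∀ U : ℝ, 0 < U → U ≤ U₀ → ∀ β : ℝ, klBetaMin ≤ β → β ≤ Real.exp (c / U ^ 2) →
          ∀ K : TrigPolyC4v, klPredsV17F2.frameOK R U (nScales β) μ K →
            ∀ (Lstar : ℕ) (Mstar : ℕ → ℕ), TowerP klPredsV17F2 G P Q R β U μ K Lstar Mstar →
              ∀ n : ℤ, ∃ L₀ : ℕ, ∃ ρ : ℕ → ℝ, Tendsto ρ atTop (𝓝 0) ∧
                ∀ (L : ℕ) [NeZero L], L₀ ≤ L → ∀ (L'' : ℕ) [NeZero L''], L ∣ L'' → ∃ M₀ : ℕ, ∀ (M : ℕ) [NeZero M], M₀ ≤ M →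
                  ∀ (ω : MatsubaraIdx M), matsubaraInt M ω = n → ∀ (k : TorusSite 2 L) (k'' : TorusSite 2 L''),
                    latticeMomentum L'' k'' = latticeMomentum L k →
                      ‖klSelfEnergy L M β U μ (klFlowFrameU L M β U μ (nScales β + 1)) klE0 (nScales β + 1) (ω, k) 0 -
                          klSelfEnergy L'' M β U μ (klFlowFrameU L'' M β U μ (nScales β + 1)) klE0 (nScales β + 1) (ω, k'') 0‖ ≤ ρ L := by
  refine framedNestedFlowTextV17F2_of_commonFramePlainRowsDual fun G P Q R hG hP hQ hR => ?_
  obtain ⟨c₅, hc₅, hc⟩ := hD G P Q R hG hP hQ hR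
  refine ⟨c₅, hc₅, fun c hc0 hcc => ?_⟩
  obtain ⟨U₀, hU₀, hU⟩ := hc c hc0 hcc
  refine ⟨U₀, hU₀, fun μ hμ U hU0 hUU β hβmin hβmax K hK Lstar Mstar hT n => ?_⟩
  have hβ : 0 < β := pos_of_klBetaMin_le hβmin
  obtain ⟨L₀, δ, B, hδ, hDn⟩ := hU μ hμ U hU0 hUU β hβmin hβmax K hK Lstar Mstar hT
  refine ⟨L₀, δ, B, hδ, fun L _ hL L'' _ b hb => ?_⟩
  obtain ⟨M₀, hM₀⟩ := hDn L hL L'' b hb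
  refine ⟨M₀, fun M _ hM => ?_⟩
  obtain ⟨oc, of, ht, hdef, hB⟩ := hM₀ M hM
  have hε : 0 ≤ 2 * imagTimeWeight β M := by have := imagTimeWeight_nonneg hβ.le M; positivity
  refine ⟨oc, of, fun ω _ => ⟨?_, ?_⟩⟩
  · exact (mul_le_mul_of_nonneg_left (dualRows_le_pinnedDefect _ _ β ω oc of ht) hε).trans hdef
  · refine le_trans (mul_le_mul_of_nonneg_left ?_ hε) hB
    rw [sum_comm]
    exact sum_le_sum fun y _ => norm_phaseRow_le _ β ω oc _

end Summit.HubbardSuperconductivity.HubbardSuperconductivity.Theorems.TwoPointAssembly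

end
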